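import Literature.MathematicalPhysics.KineticTheory.ConfinedFlowJacobian
import Literature.MathematicalPhysics.KineticTheory.ConfinedDriftKernel
import Literature.Probability.Process.BrownianPairReversal
import Mathlib.Probability.Kernel.Composition.IntegralCompProd
import HarnessLib

/-!
# Additive-noise SDEs with a confined drift: duality (time reversal) of the transition kernels with respect to Lebesgue measure

Trunk T-KINETIC (Literature/MathematicalPhysics/KineticTheory); theorems only, no named facts.
Let `Y` be a confined drift of CONSTANT divergence `tr DY ≡ d` whose reversal `Y' = -Y` is also
confined (damped Hamiltonian systems: `d = -γ · #(damped coordinates)`), let `v₁, v₂` be noise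
vectors in both noise subspaces, and let `P_T = sdeKernel Y v₁ v₂ T`, `P̂_T = sdeKernel Y' v₁ v₂ T`
be the transition kernels of `dz = ±Y(z) dt + v₁ dB¹ + v₂ dB²` (`ConfinedDriftKernel.lean`). Then
for every additive Haar measure `μ` on the state space and every `T > 0`:

  `μ(dx) P_T(x, dy) = e^{-dT} μ(dy) P̂_T(y, dx)`   on `E × E`

(`ConfinedDrift.compProd_sdeKernel_eq_smul_map_swap`), i.e. `∫ (P_T g) ψ dμ = e^{-dT} ∫ g (P̂_T ψ) dμ`:
the semigroup of the reversed drift is, up to the factor `e^{-dT}`, the ADJOINT of the semigroup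
on `L²(μ)` (for a divergence-free drift, `d = 0`, Lebesgue measure is "self-dual"; in general
this is the time-reversal / `h`-transform duality of Haussmann–Pardoux for the additive-noise
case). Proof: pathwise, `x ↦ Φ_T(x, B)` is a `C¹` bijection with Jacobian `e^{dT}` whose inverse is
the reversed flow driven by the reversed Brownian pair (`ConfinedFlowJacobian.lean`,
`ConfinedFlowReversal.lean`), and the reversed pair has the same law (`BrownianPairReversal.lean`):

* `pairNoise_pairRev` — the noise of the reversed pair is the reversed noise path on `[0, T]`;
* `ConfinedDrift.sdeSolMap_reverse` — `Ψ_T(Φ_T(x, pairPath ω), pairRev T ω) = x`, i.e. the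
  reversed SDE driven by the reversed pair inverts the solution map;
* `ConfinedDrift.lintegral_sdeKernel_duality` —
  `∫∫ H(x, y) P_T(x, dy) μ(dx) = e^{-dT} ∫∫ H(x, y) P̂_T(y, dx) μ(dy)` for measurable `H ≥ 0`;
* `ConfinedDrift.compProd_sdeKernel_eq_smul_map_swap` — the measure form displayed above;
* `ConfinedDrift.integral_sdeKernel_duality` — the Bochner form, with the integrability of the
  dual iterated integral, for `H` integrable against `μ ⊗ P_T`.

## References

* U. G. Haussmann, É. Pardoux, *Time reversal of diffusions*, Ann. Probab. 14 (1986) 1188–1205.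
* E. Nelson, *Dynamical Theories of Brownian Motion* (1967), §13 (time reversal and the adjoint
  diffusion). [folklore]
-/

noncomputable section

open MeasureTheory ProbabilityTheory Filter Topology Set Function
open scoped NNReal ENNReal

namespace Literature.MathematicalPhysics.KineticTheory

open Literature.Probability.Process Literature.Analysis.ODE

variable {E : Type*} [NormedAddCommGroup E] [NormedSpace ℝ E]

/-! ### The noise of the reversed pair -/

section Noise

variable (v₁ v₂ : E)

/-- A real time in `[0, T]`, read in `ℝ≥0`: `(T - s)⁺ = T - s⁺`. [folklore] -/
theorem toNNReal_coe_sub {T : ℝ≥0} {s : ℝ} (hs : s ∈ Icc (0 : ℝ) T) :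
    ((T : ℝ) - s).toNNReal = T - s.toNNReal := by
  have hsT : s.toNNReal ≤ T := Real.toNNReal_le_iff_le_coe.2 hs.2
  apply NNReal.coe_injective
  rw [Real.coe_toNNReal _ (sub_nonneg.2 hs.2), NNReal.coe_sub hsT, Real.coe_toNNReal _ hs.1]

/-- **The noise path of the reversed pair is the reversed noise path** on `[0, T]`:
`n(pairRev T ω)(s) = n(ω)(T - s) - n(ω)(T)`. [folklore] -/
theorem pairNoise_pairRev (T : ℝ≥0) (ω : WienerPair) {s : ℝ} (hs : s ∈ Icc (0 : ℝ) T) :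
    pairNoise v₁ v₂ (pairRev T ω) s = reversePath (pairNoise v₁ v₂ (pairPath ω)) T s := by
  have hsT : s.toNNReal ≤ T := Real.toNNReal_le_iff_le_coe.2 hs.2
  rw [pairNoise_of_continuous v₁ v₂ (continuous_pairRev_fst T ω) (continuous_pairRev_snd T ω),
    pairRev_fst_zero, pairRev_snd_zero, pairRev_fst_apply_of_le ω hsT, pairRev_snd_apply_of_le ω hsT,
    reversePath_apply, pairNoise_pairPath, pairNoise_pairPath, toNNReal_coe_sub hs, Real.toNNReal_coe]
  simp only [sub_zero, sub_smul]
  abel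

end Noise

/-! ### The reversed SDE inverts the solution map -/

namespace ConfinedDrift

variable [FiniteDimensional ℝ E] [CompleteSpace E] [MeasurableSpace E] [BorelSpace E]
  [SecondCountableTopology E] {Y Y' : E → E} (D : ConfinedDrift Y) (D' : ConfinedDrift Y')
  {v₁ v₂ : E} (hv₁ : v₁ ∈ D.noise) (hv₂ : v₂ ∈ D.noise) (hv₁' : v₁ ∈ D'.noise) (hv₂' : v₂ ∈ D'.noise)
include D D' hv₁ hv₂ hv₁' hv₂'

omit [MeasurableSpace E] [BorelSpace E] [SecondCountableTopology E] D hv₁ hv₂ in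
/-- The reversed solution map driven by the reversed pair is the reversed flow driven by the
reversed noise path (locality of the flow in the noise on `[0, T]`). [folklore] -/
theorem sdeSolMap_pairRev_eq (T : ℝ≥0) (y : E) (ω : WienerPair) :
    sdeSolMap Y' v₁ v₂ T y (pairRev T ω) =
      drivenFlow Y' y (reversePath (pairNoise v₁ v₂ (pairPath ω)) T) T := by
  unfold sdeSolMap
  have hn : Continuous (pairNoise v₁ v₂ (pairPath ω)) := continuous_pairNoise v₁ v₂ _
  exact D'.flow_congr y (continuous_pairNoise v₁ v₂ _) (continuous_reversePath hn T)
    (pairNoise_mem v₁ v₂ hv₁' hv₂' _) (fun s => reversePath_mem (pairNoise_mem v₁ v₂ hv₁' hv₂' _) T s)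
    (fun s hs => pairNoise_pairRev v₁ v₂ T ω hs) ⟨T.coe_nonneg, le_rfl⟩

omit [MeasurableSpace E] [BorelSpace E] [SecondCountableTopology E] in
/-- **The reversed SDE driven by the reversed pair inverts the solution map**:
`Ψ_T(Φ_T(x, pairPath ω), pairRev T ω) = x` (`Y' = -Y`). [folklore] -/
theorem sdeSolMap_reverse (hY' : ∀ y, Y' y = -Y y) (T : ℝ≥0) (x : E) (ω : WienerPair) :
    sdeSolMap Y' v₁ v₂ T (sdeSolMap Y v₁ v₂ T x (pairPath ω)) (pairRev T ω) = x := by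
  rw [D'.sdeSolMap_pairRev_eq hv₁' hv₂']
  exact D.flow_reverse_apply D' hY' x (continuous_pairNoise v₁ v₂ _) (pairNoise_mem v₁ v₂ hv₁ hv₂ _)
    (pairNoise_mem v₁ v₂ hv₁' hv₂' _) (pairNoise_zero v₁ v₂ _) T.coe_nonneg

omit [MeasurableSpace E] [BorelSpace E] [SecondCountableTopology E] in
/-- The solution map inverts the reversed solution map driven by the reversed pair:
`Φ_T(Ψ_T(y, pairRev T ω), pairPath ω) = y`. [folklore] -/
theorem sdeSolMap_apply_sdeSolMap_pairRev (hY' : ∀ y, Y' y = -Y y) (T : ℝ≥0) (y : E)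
    (ω : WienerPair) :
    sdeSolMap Y v₁ v₂ T (sdeSolMap Y' v₁ v₂ T y (pairRev T ω)) (pairPath ω) = y := by
  rw [D'.sdeSolMap_pairRev_eq hv₁' hv₂']
  exact D.flow_apply_flow_reverse D' hY' y (continuous_pairNoise v₁ v₂ _) (pairNoise_mem v₁ v₂ hv₁ hv₂ _)
    (pairNoise_mem v₁ v₂ hv₁' hv₂' _) (pairNoise_zero v₁ v₂ _) T.coe_nonneg

/-! ### The duality of the transition kernels -/

variable (μ : Measure E) [μ.IsAddHaarMeasure]

/-- **Duality of the transition kernels with respect to Lebesgue (Haar) measure**, Lebesgue-integral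
form: for `Y' = -Y` both confined, `tr DY ≡ d`, `T > 0` and every measurable `H : E × E → [0, ∞]`,
`∫ μ(dx) ∫ P_T(x, dy) H(x, y) = e^{-dT} ∫ μ(dy) ∫ P̂_T(y, dx) H(x, y)`. [folklore] -/
theorem lintegral_sdeKernel_duality (hY' : ∀ y, Y' y = -Y y) {d : ℝ}
    (hdiv : ∀ y, LinearMap.trace ℝ E (fderiv ℝ Y y : E →ₗ[ℝ] E) = d) {T : ℝ≥0} (hT : 0 < T)
    {H : E × E → ℝ≥0∞} (hH : Measurable H) :
    ∫⁻ x, ∫⁻ y, H (x, y) ∂(sdeKernel Y v₁ v₂ T x) ∂μ =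
      ENNReal.ofReal (Real.exp (-(d * T))) * ∫⁻ y, ∫⁻ x, H (x, y) ∂(sdeKernel Y' v₁ v₂ T y) ∂μ := by
  have hT' : (0 : ℝ) < T := hT
  -- both sides through the solution maps
  have hL : ∀ x, ∫⁻ y, H (x, y) ∂(sdeKernel Y v₁ v₂ T x) =
      ∫⁻ ω, H (x, sdeSolMap Y v₁ v₂ T x (pairPath ω)) ∂wienerPair := fun x =>
    D.lintegral_sdeKernel hv₁ hv₂ T x (hH.comp (measurable_const.prodMk measurable_id))
  have hR : ∀ y, ∫⁻ x, H (x, y) ∂(sdeKernel Y' v₁ v₂ T y) =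
      ∫⁻ ω, H (sdeSolMap Y' v₁ v₂ T y (pairPath ω), y) ∂wienerPair := fun y =>
    D'.lintegral_sdeKernel hv₁' hv₂' T y (hH.comp (measurable_id.prodMk measurable_const))
  simp_rw [hL, hR]
  -- joint measurability
  have hm1 : Measurable fun p : E × WienerPair => H (p.1, sdeSolMap Y v₁ v₂ T p.1 (pairPath p.2)) :=
    hH.comp (measurable_fst.prodMk (D.measurable_sdeSolMap_pairPath hv₁ hv₂ T))
  have hm2 : Measurable fun p : WienerPair × E => H (sdeSolMap Y' v₁ v₂ T p.2 (pairRev T p.1), p.2) := by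
    have h := (D'.measurable_sdeSolMap hv₁' hv₂' T).comp
      (measurable_snd.prodMk ((measurable_pairRev T).comp measurable_fst))
    exact hH.comp (h.prodMk measurable_snd)
  -- swap, change variables pathwise, swap back
  rw [lintegral_lintegral_swap hm1.aemeasurable]
  have hpath : ∀ ω, ∫⁻ x, H (x, sdeSolMap Y v₁ v₂ T x (pairPath ω)) ∂μ =
      ENNReal.ofReal (Real.exp (-(d * T))) *
        ∫⁻ y, H (sdeSolMap Y' v₁ v₂ T y (pairRev T ω), y) ∂μ := by
    intro ω
    have h := D.lintegral_flow_pair_eq μ D' hY' (continuous_pairNoise v₁ v₂ (pairPath ω))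
      (pairNoise_mem v₁ v₂ hv₁ hv₂ _) (pairNoise_mem v₁ v₂ hv₁' hv₂' _) (pairNoise_zero v₁ v₂ _) hT'
      hdiv hH
    simp_rw [D'.sdeSolMap_pairRev_eq hv₁' hv₂']
    exact h
  simp_rw [hpath]
  rw [lintegral_const_mul' _ _ ENNReal.ofReal_ne_top, lintegral_lintegral_swap hm2.aemeasurable]
  congr 1
  refine lintegral_congr fun y => ?_
  exact lintegral_comp_pairRev (hH.comp (((D'.measurable_sdeSolMap hv₁' hv₂' T).comp
    (measurable_const.prodMk measurable_id)).prodMk measurable_const)) T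

omit D' hv₁' hv₂' in
/-- The transition kernels are Markov kernels (instance form, for `compProd`). [folklore] -/
theorem isSFiniteKernel_sdeKernel (T : ℝ≥0) : IsSFiniteKernel (sdeKernel Y v₁ v₂ T) := by
  haveI := D.isMarkovKernel_sdeKernel hv₁ hv₂ T
  infer_instance

/-- **Duality of the transition kernels, measure form**: on `E × E`,
`μ ⊗ P_T = e^{-dT} · swap_* (μ ⊗ P̂_T)`, i.e. `μ(dx) P_T(x, dy) = e^{-dT} μ(dy) P̂_T(y, dx)`.
[folklore] -/
theorem compProd_sdeKernel_eq_smul_map_swap (hY' : ∀ y, Y' y = -Y y) {d : ℝ}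
    (hdiv : ∀ y, LinearMap.trace ℝ E (fderiv ℝ Y y : E →ₗ[ℝ] E) = d) {T : ℝ≥0} (hT : 0 < T) :
    μ ⊗ₘ sdeKernel Y v₁ v₂ T =
      ENNReal.ofReal (Real.exp (-(d * T))) • (μ ⊗ₘ sdeKernel Y' v₁ v₂ T).map Prod.swap := by
  haveI := D.isSFiniteKernel_sdeKernel hv₁ hv₂ T
  haveI := D'.isSFiniteKernel_sdeKernel hv₁' hv₂' T
  refine Measure.ext fun A hA => ?_
  have hi : Measurable (A.indicator (1 : E × E → ℝ≥0∞)) := measurable_one.indicator hA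
  have hi' : Measurable ((Prod.swap ⁻¹' A).indicator (1 : E × E → ℝ≥0∞)) :=
    measurable_one.indicator (measurable_swap hA)
  rw [Measure.smul_apply, Measure.map_apply measurable_swap hA, smul_eq_mul,
    ← lintegral_indicator_one hA, ← lintegral_indicator_one (measurable_swap hA),
    Measure.lintegral_compProd hi, Measure.lintegral_compProd hi',
    D.lintegral_sdeKernel_duality D' hv₁ hv₂ hv₁' hv₂' μ hY' hdiv hT hi]
  rfl

/-- **Lebesgue (Haar) measure is an eigenmeasure of the reversed kernels**: `∫ μ(dy) P̂_T(y, A) = e^{dT} μ(A)`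
for measurable `A` and `T > 0` (duality with `H = 1_{A × E}` and conservation of probability for
`P_T`). [folklore] -/
theorem lintegral_sdeKernel_rev_apply (hY' : ∀ y, Y' y = -Y y) {d : ℝ}
    (hdiv : ∀ y, LinearMap.trace ℝ E (fderiv ℝ Y y : E →ₗ[ℝ] E) = d) {T : ℝ≥0} (hT : 0 < T)
    {A : Set E} (hA : MeasurableSet A) :
    ∫⁻ y, sdeKernel Y' v₁ v₂ T y A ∂μ = ENNReal.ofReal (Real.exp (d * T)) * μ A := by
  haveI := D.isMarkovKernel_sdeKernel hv₁ hv₂ T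
  have hH : Measurable ((A ×ˢ (univ : Set E)).indicator (1 : E × E → ℝ≥0∞)) :=
    measurable_one.indicator (hA.prod MeasurableSet.univ)
  have h := D.lintegral_sdeKernel_duality D' hv₁ hv₂ hv₁' hv₂' μ hY' hdiv hT hH
  have hind : ∀ x y : E, (A ×ˢ (univ : Set E)).indicator (1 : E × E → ℝ≥0∞) (x, y) = A.indicator 1 x := by
    intro x y
    by_cases hx : x ∈ A
    · rw [indicator_of_mem (show (x, y) ∈ A ×ˢ (univ : Set E) from ⟨hx, mem_univ _⟩),
        indicator_of_mem hx]
      rfl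
    · rw [indicator_of_notMem (show (x, y) ∉ A ×ˢ (univ : Set E) from fun h => hx h.1),
        indicator_of_notMem hx]
  simp_rw [hind] at h
  have hL : ∫⁻ x, ∫⁻ _y, A.indicator (1 : E → ℝ≥0∞) x ∂(sdeKernel Y v₁ v₂ T x) ∂μ = μ A := by
    simp_rw [lintegral_const, measure_univ, mul_one]
    exact lintegral_indicator_one hA
  have hR : ∀ y, ∫⁻ x, A.indicator (1 : E → ℝ≥0∞) x ∂(sdeKernel Y' v₁ v₂ T y) =
      sdeKernel Y' v₁ v₂ T y A := fun y => lintegral_indicator_one hA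
  simp_rw [hR] at h
  rw [hL] at h
  -- `μ A = e^{-dT} X` gives `X = e^{dT} μ A`
  rw [h, ← mul_assoc, ← ENNReal.ofReal_mul (Real.exp_pos _).le, ← Real.exp_add,
    show d * (T : ℝ) + -(d * T) = 0 by ring, Real.exp_zero, ENNReal.ofReal_one, one_mul]

/-- **Duality of the transition kernels, Bochner form.** For `H : E × E → ℝ` integrable against
`μ ⊗ P_T`: the swapped function is integrable against `μ ⊗ P̂_T`, and
`∫ μ(dx) ∫ P_T(x, dy) H(x, y) = e^{-dT} ∫ μ(dy) ∫ P̂_T(y, dx) H(x, y)`. [folklore] -/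
theorem integral_sdeKernel_duality (hY' : ∀ y, Y' y = -Y y) {d : ℝ}
    (hdiv : ∀ y, LinearMap.trace ℝ E (fderiv ℝ Y y : E →ₗ[ℝ] E) = d) {T : ℝ≥0} (hT : 0 < T)
    {H : E × E → ℝ} (hH : Integrable H (μ ⊗ₘ sdeKernel Y v₁ v₂ T)) :
    Integrable (fun p : E × E => H p.swap) (μ ⊗ₘ sdeKernel Y' v₁ v₂ T) ∧
      ∫ x, ∫ y, H (x, y) ∂(sdeKernel Y v₁ v₂ T x) ∂μ =
        Real.exp (-(d * T)) * ∫ y, ∫ x, H (x, y) ∂(sdeKernel Y' v₁ v₂ T y) ∂μ := by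
  haveI := D.isSFiniteKernel_sdeKernel hv₁ hv₂ T
  haveI := D'.isSFiniteKernel_sdeKernel hv₁' hv₂' T
  set c : ℝ≥0∞ := ENNReal.ofReal (Real.exp (-(d * T))) with hc
  have hc0 : c ≠ 0 := (ENNReal.ofReal_pos.2 (Real.exp_pos _)).ne'
  have hkey := D.compProd_sdeKernel_eq_smul_map_swap D' hv₁ hv₂ hv₁' hv₂' μ hY' hdiv hT
  -- integrability of the swapped function
  have hH' : Integrable H (c • (μ ⊗ₘ sdeKernel Y' v₁ v₂ T).map Prod.swap) := by rwa [← hkey]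
  have hH'' : Integrable H ((μ ⊗ₘ sdeKernel Y' v₁ v₂ T).map Prod.swap) :=
    (integrable_smul_measure hc0 ENNReal.ofReal_ne_top).1 hH'
  have hswap : Integrable (fun p : E × E => H p.swap) (μ ⊗ₘ sdeKernel Y' v₁ v₂ T) :=
    (integrable_map_measure hH''.aestronglyMeasurable measurable_swap.aemeasurable).1 hH''
  refine ⟨hswap, ?_⟩
  rw [← Measure.integral_compProd hH, hkey, integral_smul_measure,
    integral_map measurable_swap.aemeasurable hH''.aestronglyMeasurable, Measure.integral_compProd hswap,
    ENNReal.toReal_ofReal (Real.exp_pos _).le, smul_eq_mul]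
  rfl

end ConfinedDrift

end Literature.MathematicalPhysics.KineticTheory
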